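import Summits.CriticalPhenomena.PercolationContinuityZ3.Theorems.PercNearOneGluingNoHeavyQuantFarSunGame
import Mathlib.Algebra.Order.Floor.Defs
import Mathlib.Data.Rat.Floor
import Mathlib.Data.Real.Basic
import Mathlib.Tactic.Linarith
import Mathlib.Tactic.Positivity
import Mathlib.Tactic.Push
import Mathlib.Tactic.Ring
import HarnessLib

/-!
# FAR beyond trees: the THRESHOLD SCHEDULE of the `R`-slack game certificates

builds on p205010 (kernel theorem, internal audit signed; external expert review pending)

Support file (`--supports stmt-CriticalPhenomena-4575`), seat `prim-cert-1` (gen 39); memo `prim-cert-1/FROM-prim-cert-1-g39-VERTEX-GAME.md` §8.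
Computable data used to STATE the `K = 12` threshold certificates (…CertCells12B/C) of the λ-refined game (…GameLam, `gameCertT`): the schedule
**`GameSpec.thr`** `t_B = min(⌈−(lamN/lamD)·c_B·q^K·Lpay⌉, 0)` with `c_B = 1 − hi − hi·(υ·B − 4)/2` (on `R`, `1 − F > 1 − η − η(Σ−4)/2 ≥ c_B` when the least
weight is `η < hi` and the mass is `Σ ≤ υB`, `υB ≥ 2`), the list **`GameSpec.thrList`** `[(B, t_B)]`, membership `GameSpec.mem_thrList`, and the bound
**`GameSpec.neg_le_thr`**: `−(lamN/lamD)·max(c_B, 0)·q^K·Lpay ≤ t_B` (consumed by `HairyCycle.witGavg_ge_one_of_cellGameT`, …GameLamAvg).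
Elementary [this work]; no sorries; standard axioms.
-/

namespace Summit.CriticalPhenomena.PercolationContinuityZ3.Theorems.HairyCycle

namespace GameSpec

variable (P : GameSpec)

/-! ## The schedule -/

/-- Threshold `t_B = min(⌈−(lamN/lamD)·c_B·q^K·Lpay⌉, 0)`, `c_B = 1 − hi − hi·(υ·B − 4)/2`. [this work] -/
def thr (lamN lamD : ℕ) (hi υ : ℚ) (K B : ℕ) : ℤ :=
  min ⌈-((lamN : ℚ) / lamD) * (1 - hi - hi * (υ * B - 4) / 2) * ((P.q : ℚ) ^ K * P.Lpay)⌉ 0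

/-- The list `[(B, t_B) | B = Bmin, …, Bmin + n − 1]`. [this work] -/
def thrList (lamN lamD : ℕ) (hi υ : ℚ) (K Bmin n : ℕ) : List (ℕ × ℤ) :=
  (List.range' Bmin n).map fun B => (B, P.thr lamN lamD hi υ K B)

/-- Membership in the threshold list. [this work] -/
theorem mem_thrList {lamN lamD : ℕ} {hi υ : ℚ} {K Bmin n B : ℕ} (h1 : Bmin ≤ B) (h2 : B < Bmin + n) :
    (B, P.thr lamN lamD hi υ K B) ∈ P.thrList lamN lamD hi υ K Bmin n := by
  unfold thrList
  rw [List.mem_map]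
  exact ⟨B, List.mem_range'_1.2 ⟨h1, h2⟩, rfl⟩

/-- **`−λ·max(c_B, 0)·q^K·Lpay ≤ t_B`.** [this work] -/
theorem neg_le_thr (lamN lamD : ℕ) (hi υ : ℚ) (K B : ℕ) :
    -(((lamN : ℝ) / lamD) * max (1 - (hi : ℝ) - hi * ((υ : ℝ) * B - 4) / 2) 0 * ((P.q : ℝ) ^ K * P.Lpay)) ≤
      (P.thr lamN lamD hi υ K B : ℝ) := by
  set c : ℚ := 1 - hi - hi * (υ * B - 4) / 2 with hc
  have hcR : (c : ℝ) = 1 - (hi : ℝ) - hi * ((υ : ℝ) * B - 4) / 2 := by rw [hc]; push_cast; ring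
  have hlam0 : (0 : ℝ) ≤ (lamN : ℝ) / lamD := by positivity
  have hM : (0 : ℝ) ≤ (P.q : ℝ) ^ K * P.Lpay := by positivity
  have hlamM : (0 : ℝ) ≤ (lamN : ℝ) / lamD * ((P.q : ℝ) ^ K * P.Lpay) := mul_nonneg hlam0 hM
  have hmax0 : (0 : ℝ) ≤ max (c : ℝ) 0 := le_max_right _ _
  have hmaxc : (c : ℝ) ≤ max (c : ℝ) 0 := le_max_left _ _
  rw [← hcR]
  unfold thr
  rw [← hc]
  rcases le_total ⌈-((lamN : ℚ) / lamD) * c * ((P.q : ℚ) ^ K * P.Lpay)⌉ 0 with hle | hle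
  · rw [min_eq_left hle]
    have h1 : -((lamN : ℚ) / lamD) * c * ((P.q : ℚ) ^ K * P.Lpay) ≤ (⌈-((lamN : ℚ) / lamD) * c * ((P.q : ℚ) ^ K * P.Lpay)⌉ : ℚ) :=
      Int.le_ceil _
    have h2 : ((-((lamN : ℚ) / lamD) * c * ((P.q : ℚ) ^ K * P.Lpay) : ℚ) : ℝ) ≤
        ((⌈-((lamN : ℚ) / lamD) * c * ((P.q : ℚ) ^ K * P.Lpay)⌉ : ℤ) : ℝ) := by exact_mod_cast h1
    have h3 : ((-((lamN : ℚ) / lamD) * c * ((P.q : ℚ) ^ K * P.Lpay) : ℚ) : ℝ) = -((lamN : ℝ) / lamD) * (c : ℝ) * ((P.q : ℝ) ^ K * P.Lpay) := by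
      push_cast; ring
    rw [h3] at h2
    nlinarith [mul_le_mul_of_nonneg_left hmaxc hlamM]
  · rw [min_eq_right hle]
    push_cast
    nlinarith [mul_nonneg hlamM hmax0]

end GameSpec

end Summit.CriticalPhenomena.PercolationContinuityZ3.Theorems.HairyCycle
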